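import Literature.MathematicalPhysics.QuantumFieldTheory.Balaban1983to89.AveragingRT

/-!
# SUBSTRATE — THE AXIAL AVERAGE IS FIBRED: a measurable, Haar-compatible parametrisation of the fine gauge field by
# (the non-last bond variables, the coarse field), solving the last bond of every line

Cell `pub-balaban`, SUBSTRATE cell, seat `b2b-balaban-substrate-p2`; registry item S-F2, follower S-F2-∃ of
`Support/SubstrateFibredAveraging` (typer sketch v0.2 §F2 `FibredAxial_stmt`).  Summits-side bookkeeping; imports `AveragingRT` (the axial
average `axialAvg`, its lines, `last_injective`, `line_ne_last`, `measurePreserving_mulLeft`) BY NAME; edits nothing; independent of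
`SubstrateFibredAveraging` (the packaging into its `FibredAveraging` structure is the companion `SubstrateFibredAxialRT`).

HONEST FRAMING (T4-DAG p. 1).  Rung (B)+1 of the FINITE-VOLUME T⁴ continuum programme — NOT infinite volume, NOT a mass gap, NOT the
Clay problem, NOT summit progress, no estimate.  The axial (decimation) average is the tree's INHABITANT of `Setup.Averaging`
([Balaban1984PropagatorsI] (1.7) p. 18: transport along the straight line of `L` bonds), NOT Bałaban's weighted block average (0.12) of
[Balaban1987RG1] (whose fibred structure, B12 §1, is the typer's untyped `FibredBlockAvg_stmt`).  What is constructed: for the axial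
average, the fine field IS (non-last bond variables, coarse field) — measurably and Haar-compatibly — so the fibre transport of
`SubstrateFibredAveraging` is an everywhere-defined renormalization transform for the axial scheme (companion `SubstrateFibredAxialRT`).  HONEST DEPENDENCY (cell line, verbatim): continuum YM on T⁴ ⇐ BetaPertH ∧ nine spine estimates (0/9 proved);
BetaPertH ⇐ (D1) ∧ (D4) ∧ CAP+tail; G-an2-4 gates asym, D1 and NE2/3/4.

WHAT THIS FILE DOES (standing range `j + 1 ≤ m + K`; `G` with measurable multiplication and inversion).
* §1 the LAST bonds `last c = line c (L−1)` (injective: `AveragingRT.last_injective`), the predicate `IsLast`, the fluctuation space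
  `Z := {b // ¬ IsLast b} → G` with product Haar `muZ`, and the FILL map `fill (z, w)` (non-last bonds from `z`, the last bond of line `c`
  from `w c`) — a measurable equivalence `Z × 𝒰_{j+1} ≃ 𝒰_j` pushing `μ_Z ⊗ dV` to `dU` (`measurePreserving_fill`: Mathlib's
  `measurePreserving_piEquivPiSubtypeProd` + `measurePreserving_piCongrLeft` along `last`);
* §2 the partial transports along the first `L−1` bonds of a line read only non-last bonds (`pathProd_fill_eq`), so `pp z c :=` that
  transport is a function of `z`; the SHEAR `shear (z, V) := (z, c ↦ (pp z c)⁻¹·V c)` preserves `μ_Z ⊗ dV` (`MeasurePreserving.skew_product`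
  with the left-invariance `AveragingRT.measurePreserving_mulLeft`);
* §3–§4 the parametrisation `phiAx := fill ∘ shear` with **`axialAvg_phiAx`** (`axialAvg (phiAx (z, V)) = V`, from `axialAvg U c = pathProd U c (L−1) ·
  U(last c)`), `measurable_phiAx`, and **`map_phiAx`** (`phiAx_*(μ_Z ⊗ dV) = dU`) — exactly the three fields of
  `SubstrateFibredAveraging.FibredAveraging` for `axialAvg`; the packaging `fibredAxial : FibredAveraging P j G axialAvg` (= the typer's
  `FibredAxial_stmt`, with the measurability instances `MeasurableMul₂ G`, `MeasurableInv G` the sketch leaves implicit) and the axial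
  fibre transport as a renormalization transform are the companion `Support/SubstrateFibredAxialRT` (imports both modules).
No estimate, no `def … : Prop`, no `sorry`.

References (KIND only): [Balaban1984PropagatorsI] (1.7) p. 18; [Balaban1985Averaging] (10)–(11) p. 19.
-/

noncomputable section

open scoped BigOperators
open _root_.MeasureTheory

namespace Summit.QuantumFields.BalabanUV.T4Continuum.SubstrateFibredAxial

open Literature.MathematicalPhysics.QuantumFieldTheory.Balaban1983to89
open Literature.MathematicalPhysics.QuantumFieldTheory.Balaban1983to89.AveragingRT
  (line pathProd axialAvg last_injective line_ne_last measurable_pathProd measurePreserving_mulLeft)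
variable {P : Params} {j : ℕ} {G : Type}

/-! ## §1 Last bonds, the fluctuation space, the fill map -/

/-- [folklore] The LAST bond of the line of the coarse bond `c`: `line c (L − 1)`. -/
def last (c : PBond P (j + 1)) : PBond P j := line c (P.L - 1)

/-- [folklore] `last` unfolded. -/
theorem last_eq (c : PBond P (j + 1)) : last c = line c (P.L - 1) := rfl

/-- [folklore] Distinct lines have distinct last bonds (standing range; `AveragingRT.last_injective`). -/
theorem last_injective' (hj : j + 1 ≤ P.m + P.K) : Function.Injective (last (P := P) (j := j)) :=
  last_injective hj

/-- [folklore] A fine bond IS A LAST BOND of some line. -/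
def IsLast (b : PBond P j) : Prop := b ∈ Set.range (last (P := P) (j := j))

/-- [folklore] Decidability of `IsLast` (classical). -/
instance instDecidablePredIsLast : DecidablePred (IsLast (P := P) (j := j)) := Classical.decPred _

/-- [folklore] An earlier bond of a line is not a last bond (standing range; `AveragingRT.line_ne_last`). -/
theorem not_isLast_line (hj : j + 1 ≤ P.m + P.K) (c : PBond P (j + 1)) {t : ℕ} (ht : t < P.L - 1) : ¬ IsLast (line c t) := by
  rintro ⟨c', hc'⟩
  exact line_ne_last hj c c' ht hc'.symm

/-- [folklore] The coarse bonds ARE the last bonds (`Equiv.ofInjective last`). -/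
def lastEquiv (hj : j + 1 ≤ P.m + P.K) : PBond P (j + 1) ≃ {b : PBond P j // IsLast b} :=
  Equiv.ofInjective last (last_injective' hj)

/-- [folklore] `lastEquiv hj c = ⟨last c, _⟩`. -/
@[simp] theorem lastEquiv_apply_val (hj : j + 1 ≤ P.m + P.K) (c : PBond P (j + 1)) : ((lastEquiv hj c) : PBond P j) = last c := rfl

/-- [folklore] THE FLUCTUATION VARIABLES of the axial scheme: the gauge field on the NON-LAST bonds. -/
def Z (P : Params) (j : ℕ) (G : Type) : Type := {b : PBond P j // ¬ IsLast b} → G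

/-- [folklore] THE FILL MAP: non-last bonds from the fluctuation variables, the last bond of the line of `c` from `w c`. -/
def fill (hj : j + 1 ≤ P.m + P.K) (zw : Z P j G × GaugeField P (j + 1) G) : GaugeField P j G :=
  fun b => if h : IsLast b then zw.2 ((lastEquiv hj).symm ⟨b, h⟩) else zw.1 ⟨b, h⟩

/-- [folklore] The fill map on a last bond reads the coarse component. -/
theorem fill_last (hj : j + 1 ≤ P.m + P.K) (z : Z P j G) (w : GaugeField P (j + 1) G) (c : PBond P (j + 1)) :
    fill hj (z, w) (last c) = w c := by
  have h : IsLast (last c) := ⟨c, rfl⟩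
  simp only [fill, dif_pos h]
  congr 1
  rw [Equiv.symm_apply_eq]
  exact Subtype.ext rfl

/-- [folklore] The fill map on a non-last bond reads the fluctuation component. -/
theorem fill_of_not_isLast (hj : j + 1 ≤ P.m + P.K) (z : Z P j G) (w : GaugeField P (j + 1) G) {b : PBond P j}
    (h : ¬ IsLast b) : fill hj (z, w) b = z ⟨b, h⟩ := by
  simp only [fill, dif_neg h]

/-! ## §2 The partial transports read only the fluctuation variables; the shear (algebra) -/

section Algebra

variable [GaugeGroup G]

/-- [folklore] The partial transport along the first `n ≤ L − 1` bonds of a line does not read the last bonds: it is the same for all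
coarse components of the fill. -/
theorem pathProd_fill_eq (hj : j + 1 ≤ P.m + P.K) (z : Z P j G) (w w' : GaugeField P (j + 1) G) (c : PBond P (j + 1)) :
    ∀ n, n ≤ P.L - 1 → pathProd (fill hj (z, w)) c n = pathProd (fill hj (z, w')) c n
  | 0, _ => rfl
  | n + 1, hn => by
    simp only [pathProd]
    rw [pathProd_fill_eq hj z w w' c n (by omega), fill_of_not_isLast hj z w (not_isLast_line hj c (by omega)),
      fill_of_not_isLast hj z w' (not_isLast_line hj c (by omega))]

/-- [folklore] THE TRANSPORT ALONG THE FIRST `L − 1` BONDS as a function of the fluctuation variables. -/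
def pp (hj : j + 1 ≤ P.m + P.K) (z : Z P j G) (c : PBond P (j + 1)) : G := pathProd (fill hj (z, 1)) c (P.L - 1)

/-- [folklore] … equal to the partial transport of ANY fill with these fluctuation variables. -/
theorem pathProd_fill (hj : j + 1 ≤ P.m + P.K) (z : Z P j G) (w : GaugeField P (j + 1) G) (c : PBond P (j + 1)) :
    pathProd (fill hj (z, w)) c (P.L - 1) = pp hj z c :=
  pathProd_fill_eq hj z w 1 c _ le_rfl

/-- [folklore] **THE AXIAL AVERAGE OF A FILL**: `axialAvg (fill (z, w)) c = pp z c · w c` — transport along the first `L − 1` bonds, then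
the last bond. -/
theorem axialAvg_fill (hj : j + 1 ≤ P.m + P.K) (z : Z P j G) (w : GaugeField P (j + 1) G) (c : PBond P (j + 1)) :
    axialAvg (fill hj (z, w)) c = pp hj z c * w c := by
  have hL : P.L = P.L - 1 + 1 := by have := P.hL.2; omega
  show pathProd (fill hj (z, w)) c P.L = _
  rw [hL]
  show pathProd (fill hj (z, w)) c (P.L - 1) * fill hj (z, w) (line c (P.L - 1)) = _
  rw [pathProd_fill, ← last_eq, fill_last]

/-- [folklore] THE SHEAR: solve the last bond — `(z, V) ↦ (z, c ↦ (pp z c)⁻¹ · V c)`. -/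
def shear (hj : j + 1 ≤ P.m + P.K) (zV : Z P j G × GaugeField P (j + 1) G) : Z P j G × GaugeField P (j + 1) G :=
  (zV.1, fun c => (pp hj zV.1 c)⁻¹ * zV.2 c)

/-- [folklore] THE PARAMETRISATION `Φ := fill ∘ shear`. -/
def phiAx (hj : j + 1 ≤ P.m + P.K) (zV : Z P j G × GaugeField P (j + 1) G) : GaugeField P j G := fill hj (shear hj zV)

/-- [folklore] `Φ` parametrises the fibres of the axial average: `axialAvg (Φ (z, V)) = V`. -/
theorem axialAvg_phiAx (hj : j + 1 ≤ P.m + P.K) (z : Z P j G) (V : GaugeField P (j + 1) G) : axialAvg (phiAx hj (z, V)) = V := by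
  funext c
  show axialAvg (fill hj (z, fun c => (pp hj z c)⁻¹ * V c)) c = V c
  rw [axialAvg_fill, mul_inv_cancel_left]

end Algebra

/-! ## §3 Measurability -/

section Measurability

variable [MeasurableSpace G]

/-- [folklore] Product measurable structure on the fluctuation variables. -/
instance instMeasurableSpaceZ : MeasurableSpace (Z P j G) := inferInstanceAs (MeasurableSpace ({b : PBond P j // ¬ IsLast b} → G))

/-- [folklore] The fill map AS A MEASURABLE EQUIVALENCE: Mathlib's split `𝒰_j ≃ (last bonds → G) × (non-last bonds → G)` composed with
the re-indexing of the last bonds by the coarse bonds and a swap. -/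
def fillEquiv (hj : j + 1 ≤ P.m + P.K) : Z P j G × GaugeField P (j + 1) G ≃ᵐ GaugeField P j G :=
  (MeasurableEquiv.prodComm.trans
    (MeasurableEquiv.prodCongr (MeasurableEquiv.piCongrLeft (fun _ : {b : PBond P j // IsLast b} => G) (lastEquiv hj))
      (MeasurableEquiv.refl (Z P j G)))).trans
    (MeasurableEquiv.piEquivPiSubtypeProd (fun _ : PBond P j => G) IsLast).symm

/-- [folklore] The measurable equivalence IS the fill map. -/
theorem fillEquiv_apply (hj : j + 1 ≤ P.m + P.K) (zw : Z P j G × GaugeField P (j + 1) G) : fillEquiv hj zw = fill hj zw := by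
  obtain ⟨z, w⟩ := zw
  funext b
  by_cases h : IsLast b
  · simp only [fill, dif_pos h]
    show (Equiv.piEquivPiSubtypeProd IsLast fun _ : PBond P j => G).symm
        (MeasurableEquiv.piCongrLeft (fun _ : {b : PBond P j // IsLast b} => G) (lastEquiv hj) w, z) b = _
    rw [Equiv.piEquivPiSubtypeProd_symm_apply, dif_pos h]
    have key := MeasurableEquiv.piCongrLeft_apply_apply (lastEquiv hj) (β := fun _ : {b : PBond P j // IsLast b} => G) w
      ((lastEquiv hj).symm ⟨b, h⟩)
    rw [Equiv.apply_symm_apply] at key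
    exact key
  · simp only [fill, dif_neg h]
    show (Equiv.piEquivPiSubtypeProd IsLast fun _ : PBond P j => G).symm
        (MeasurableEquiv.piCongrLeft (fun _ : {b : PBond P j // IsLast b} => G) (lastEquiv hj) w, z) b = _
    rw [Equiv.piEquivPiSubtypeProd_symm_apply, dif_neg h]

/-- [folklore] The fill map is measurable. -/
theorem measurable_fill (hj : j + 1 ≤ P.m + P.K) : Measurable (fill (G := G) hj) := by
  have h : (fill (G := G) hj) = fillEquiv hj := funext fun zw => (fillEquiv_apply hj zw).symm
  rw [h]
  exact (fillEquiv hj).measurable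

variable [GaugeGroup G] [MeasurableMul₂ G]

/-- [folklore] `pp` is measurable in the fluctuation variables. -/
theorem measurable_pp (hj : j + 1 ≤ P.m + P.K) (c : PBond P (j + 1)) : Measurable fun z : Z P j G => pp hj z c :=
  (measurable_pathProd c (P.L - 1)).comp ((measurable_fill hj).comp (measurable_id.prodMk measurable_const))

variable [MeasurableInv G]

/-- [folklore] The fibrewise part of the shear is jointly measurable. -/
theorem measurable_shear_snd (hj : j + 1 ≤ P.m + P.K) :
    Measurable (Function.uncurry fun (z : Z P j G) (V : GaugeField P (j + 1) G) => (fun c => (pp hj z c)⁻¹ * V c :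
      GaugeField P (j + 1) G)) := by
  refine measurable_pi_iff.2 fun c => ?_
  exact (((measurable_pp hj c).comp measurable_fst).inv).mul ((measurable_pi_apply c).comp measurable_snd)

/-- [folklore] The shear is measurable. -/
theorem measurable_shear (hj : j + 1 ≤ P.m + P.K) : Measurable (shear (G := G) hj) :=
  measurable_fst.prodMk (measurable_shear_snd hj)

/-- [folklore] `Φ` is measurable. -/
theorem measurable_phiAx (hj : j + 1 ≤ P.m + P.K) : Measurable (phiAx (G := G) hj) :=
  (measurable_fill hj).comp (measurable_shear hj)

end Measurability

/-! ## §4 Haar compatibility and the fibred structure of the axial average -/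

/-- [folklore] THE FLUCTUATION MEASURE: product Haar on the non-last bonds. -/
def muZ (P : Params) (j : ℕ) (G : Type) [GaugeGroup G] [MeasurableSpace G] [HaarData G] : Measure (Z P j G) :=
  Measure.pi fun _ : {b : PBond P j // ¬ IsLast b} => (HaarData.haar : Measure G)

/-- [folklore] The fluctuation measure is a probability measure. -/
instance instIsProbabilityMeasureMuZ {P : Params} {j : ℕ} {G : Type} [GaugeGroup G] [MeasurableSpace G] [HaarData G] :
    IsProbabilityMeasure (muZ P j G) := by
  unfold muZ; exact Measure.pi.instIsProbabilityMeasure _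

section Haar

variable [GaugeGroup G] [MeasurableSpace G] [HaarData G]

/-- [folklore] **THE FILL MAP PUSHES `μ_Z ⊗ dV` TO `dU`** (product Haar splits along the partition of the fine bonds into non-last and
last bonds; the last bonds are re-indexed by the coarse bonds). -/
theorem measurePreserving_fill (hj : j + 1 ≤ P.m + P.K) :
    MeasurePreserving (fill (G := G) hj) ((muZ P j G).prod (fieldMeasure P (j + 1) G)) (fieldMeasure P j G) := by
  have h : (fill (G := G) hj) = fillEquiv hj := funext fun zw => (fillEquiv_apply hj zw).symm
  -- work at the level of the product Haar measures on the `Pi` types (`fieldMeasure` unfolds to `Measure.pi`)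
  show MeasurePreserving (fill (G := G) hj)
    ((muZ P j G).prod (Measure.pi fun _ : PBond P (j + 1) => (HaarData.haar : Measure G)))
    (Measure.pi fun _ : PBond P j => (HaarData.haar : Measure G))
  rw [h]
  have hL : MeasurePreserving (MeasurableEquiv.piCongrLeft (fun _ : {b : PBond P j // IsLast b} => G) (lastEquiv hj))
      (Measure.pi fun _ : PBond P (j + 1) => (HaarData.haar : Measure G))
      (Measure.pi fun _ : {b : PBond P j // IsLast b} => (HaarData.haar : Measure G)) :=
    measurePreserving_piCongrLeft (fun _ : {b : PBond P j // IsLast b} => (HaarData.haar : Measure G)) (lastEquiv hj)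
  have hsplit := (measurePreserving_piEquivPiSubtypeProd (fun _ : PBond P j => (HaarData.haar : Measure G)) IsLast).symm _
  have hswap : MeasurePreserving (MeasurableEquiv.prodComm : Z P j G × (PBond P (j + 1) → G) ≃ᵐ _)
      ((muZ P j G).prod (Measure.pi fun _ : PBond P (j + 1) => (HaarData.haar : Measure G)))
      ((Measure.pi fun _ : PBond P (j + 1) => (HaarData.haar : Measure G)).prod (muZ P j G)) :=
    Measure.measurePreserving_swap
  have hcongr : MeasurePreserving
      (MeasurableEquiv.prodCongr (MeasurableEquiv.piCongrLeft (fun _ : {b : PBond P j // IsLast b} => G) (lastEquiv hj))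
        (MeasurableEquiv.refl (Z P j G)))
      ((Measure.pi fun _ : PBond P (j + 1) => (HaarData.haar : Measure G)).prod (muZ P j G))
      ((Measure.pi fun _ : {b : PBond P j // IsLast b} => (HaarData.haar : Measure G)).prod (muZ P j G)) :=
    hL.prod (MeasurePreserving.id _)
  exact hsplit.comp (hcongr.comp hswap)

variable [MeasurableMul₂ G] [MeasurableInv G]

/-- [folklore] **THE SHEAR PRESERVES `μ_Z ⊗ dV`** (a skew product whose fibre maps are left multiplications by fixed fields — Haar left
invariance, `AveragingRT.measurePreserving_mulLeft`). -/
theorem measurePreserving_shear (hj : j + 1 ≤ P.m + P.K) :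
    MeasurePreserving (shear (G := G) hj) ((muZ P j G).prod (fieldMeasure P (j + 1) G)) ((muZ P j G).prod (fieldMeasure P (j + 1) G)) :=
  (MeasurePreserving.id (muZ P j G)).skew_product (measurable_shear_snd hj)
    (Filter.Eventually.of_forall fun z => (measurePreserving_mulLeft (P := P) (j := j + 1) fun c => (pp hj z c)⁻¹).map_eq)

/-- [folklore] `Φ` pushes `μ_Z ⊗ dV` to `dU`. -/
theorem map_phiAx (hj : j + 1 ≤ P.m + P.K) :
    ((muZ P j G).prod (fieldMeasure P (j + 1) G)).map (phiAx (G := G) hj) = fieldMeasure P j G :=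
  ((measurePreserving_fill hj).comp (measurePreserving_shear hj)).map_eq

end Haar

end Summit.QuantumFields.BalabanUV.T4Continuum.SubstrateFibredAxial

end
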